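/-
Copyright: the b2b-balaban T⁴-continuum CRUX team, row NE7b OWNER lineage `t4-ne7b-p1` (gen 130). Project licence.
-/
import Summits.QuantumFields.BalabanUV.T4Continuum.Spine.NE7b.SupFibreGaussianIBPTilted
import Summits.QuantumFields.BalabanUV.T4Continuum.Spine.NE7b.SupConvexFibreIntegral
import Mathlib.Analysis.Calculus.FDeriv.Measurable

/-!
# THE TILTED GAUSSIAN IBP ON THE FIBRE WITH ITS INTEGRABILITY DISCHARGED: (277)'s identity
# `∫ ⟨f,Pz⟩G(Pz)e^{−W(Pz)}ρ dz = ∫ (DG(Pz)(Cf) − G(Pz)·DW(Pz)(Cf))e^{−W(Pz)}ρ dz` (`ρ = e^{−½H(Pz)(Pz)}`, `Cf = PM_z⁻¹Pᵀf`) holds for every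
# differentiable observable `G` and interaction `W` in the GAUSSIAN-ENVELOPE class — `|G|, |DG(Cf)|, |DW(Cf)| ≤ A·e^{cΣφ²}`, stability
# `W ≥ −κ₀Σφ²` — as soon as the envelope fits under the form's floor read through the chart: `(2c+κ₀)q + δ < mp∕2` (`mΣh² ≤ H(h,h)`,
# `pΣz² ≤ Σ(Pz)² ≤ qΣz²`); the three integrability hypotheses of (277) are DISCHARGED by the product-Gaussian envelope `Ce^{−aΣz²}` of (115)
# (row NE7b, node U5c — § G127 (e) «IBP for the non-Gaussian fluctuation measure»: the integrability half; (277)∕(115) BY NAME; [folklore])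

Cell `pub-balaban`, sub-cell `t4`, spine estimate NE7b (`T4WeightBudget.RelWeightBound`; the cell's OWN estimate — NOT PRINTED in
[Bałaban 1983–89], NOT PROVED).  Crux-route work under `Spine/NE7b/` by the row OWNER (`t4-ne7b-p1` gen 130, file (334)) under FREEZE
(0)'s crux-prover clause, on § [NE7bP1-G129-HANDOFF] NEXT (iv) (= § G127 (e)); NOTHING of Bałaban's is named as a Lean object, valued or
asserted; no `T4Continuum/Support` leaf typed; no `def`, no notation; zero `sorry`.  Imports (BY NAME): the OWNER's (277)
`…SupFibreGaussianIBPTilted` (`fibre_gaussian_ibp_tilted`), (115) `…SupConvexFibreIntegral` (`integrable_gaussian_pi`); Mathlib's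
`measurable_fderiv_apply_const`, `Real.add_one_le_exp`.

WHAT IS PROVED ([folklore]; `σ` finite, Lebesgue measure on `σ → ℝ`):
* §1 `exp_neg_half_form_le` (`e^{−½H(Pz)(Pz)} ≤ e^{−(mp∕2)Σz²}`), **`integrable_of_gaussian_envelope`** (`|Φ| ≤ Ae^{cΣz²}`, `c < mp∕2`, `Φ`
  a.e.-strongly measurable ⟹ `Φ·ρ` integrable), `sum_sq_le_inv_mul_exp` (`Σz² ≤ δ⁻¹e^{δΣz²}`), `abs_pairing_le` (`|Σf_x(Pz)_x| ≤ ½(Σf² + Σ(Pz)²)`),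
  `exp_mul_le_exp_mul_of_le` (monotonicity of the envelope);
* §2 THE END **`fibre_gaussian_ibp_tilted_of_envelope`**; §3 toy.

HONEST (what this is NOT).  Integrability only (the identity is (277)'s); the envelope letters are hypotheses on `G, W` at the ONE covariance
vector `Cf` (displayed as `u` with its defining equation); the chart's upper bound `Σ(Pz)² ≤ qΣz²` is a hypothesis; nothing of cluster
expansions; scalar skeleton ((A3), NC-NE7b-α UNRULED); nothing of Bałaban's asserted.  BY-NAME EFFECT ON THE WALL: NONE.  NE7b NOT PRINTED ∕
NOT PROVED; spine PROVED 0∕9; rung (B)+1 — the programme's measures remain FINITE-torus statements; NOT the mass gap, NOT Clay.  HONEST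
DEPENDENCY: continuum YM on T⁴ ⇐ BetaPertH ∧ nine spine estimates (0∕9 proved); BetaPertH ⇐ (D1) ∧ (D4) ∧ CAP+tail; G-an2-4 gates asym, D1
and NE2∕3∕4.
-/

set_option autoImplicit false

noncomputable section

namespace Summit.QuantumFields.BalabanUV.T4Continuum.NE7b.SupFibreGaussianIBPEnvelope

open MeasureTheory Real
open SupFibreGaussianIBPTilted (fibre_gaussian_ibp_tilted)
open SupConvexFibreIntegral (integrable_gaussian_pi)

variable {ι : Type*} [Fintype ι] {σ : Type} [Fintype σ] [DecidableEq σ]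
  {H : (ι → ℝ) →L[ℝ] (ι → ℝ) →L[ℝ] ℝ} {m p : ℝ} (P : (σ → ℝ) →L[ℝ] (ι → ℝ))

/-! ## §1. The Gaussian envelope -/

omit [DecidableEq σ] in
/-- **The density under the floor read through the chart**: `mΣh² ≤ H(h,h)`, `0 ≤ m`, `pΣz² ≤ Σ(Pz)²` ⟹ `e^{−½H(Pz)(Pz)} ≤ e^{−(mp∕2)Σz²}`.
[folklore] -/
theorem exp_neg_half_form_le (hfl : ∀ h : ι → ℝ, m * ∑ x, h x ^ 2 ≤ H h h) (hm : 0 ≤ m)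
    (hP : ∀ z : σ → ℝ, p * ∑ i, z i ^ 2 ≤ ∑ x, P z x ^ 2) (z : σ → ℝ) :
    exp (-((1 / 2 : ℝ) * H (P z) (P z))) ≤ exp (-(m * p / 2) * ∑ i, z i ^ 2) := by
  refine exp_le_exp.2 ?_
  have h1 := hfl (P z)
  have h2 := mul_le_mul_of_nonneg_left (hP z) hm
  nlinarith

omit [DecidableEq σ] in
/-- **INTEGRABILITY FROM A GAUSSIAN ENVELOPE**: `mΣh² ≤ H(h,h)` (`m ≥ 0`), `pΣz² ≤ Σ(Pz)²`, `Φ` a.e.-strongly measurable with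
`|Φ(z)| ≤ A·e^{cΣz²}` and `c < mp∕2` ⟹ `z ↦ Φ(z)e^{−½H(Pz)(Pz)}` is integrable ((115)'s product Gaussian `Ae^{−(mp∕2−c)Σz²}` dominates).
[folklore] -/
theorem integrable_of_gaussian_envelope (hfl : ∀ h : ι → ℝ, m * ∑ x, h x ^ 2 ≤ H h h) (hm : 0 ≤ m)
    (hP : ∀ z : σ → ℝ, p * ∑ i, z i ^ 2 ≤ ∑ x, P z x ^ 2) {Φ : (σ → ℝ) → ℝ} (hΦm : AEStronglyMeasurable Φ volume) {A c : ℝ}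
    (hc : c < m * p / 2) (hΦ : ∀ z, |Φ z| ≤ A * exp (c * ∑ i, z i ^ 2)) :
    Integrable fun z : σ → ℝ => Φ z * exp (-((1 / 2 : ℝ) * H (P z) (P z))) := by
  have hρc : Continuous fun z : σ → ℝ => exp (-((1 / 2 : ℝ) * H (P z) (P z))) :=
    continuous_exp.comp ((H.continuous₂.comp (P.continuous.prodMk P.continuous)).const_mul _).neg
  refine (integrable_gaussian_pi (σ := σ) (a := m * p / 2 - c) (by linarith) A).mono' (hΦm.mul hρc.aestronglyMeasurable)
    (ae_of_all _ fun z => ?_)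
  rw [norm_mul, Real.norm_eq_abs, Real.norm_of_nonneg (exp_pos _).le]
  have hA : 0 ≤ A * exp (c * ∑ i, z i ^ 2) := (abs_nonneg _).trans (hΦ z)
  calc |Φ z| * exp (-((1 / 2 : ℝ) * H (P z) (P z)))
      ≤ (A * exp (c * ∑ i, z i ^ 2)) * exp (-(m * p / 2) * ∑ i, z i ^ 2) :=
        mul_le_mul (hΦ z) (exp_neg_half_form_le P hfl hm hP z) (exp_pos _).le hA
    _ = A * exp (-(m * p / 2 - c) * ∑ i, z i ^ 2) := by
        rw [mul_assoc, ← exp_add]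
        congr 2
        ring

omit [DecidableEq σ] in
/-- `0 < δ` ⟹ `Σz² ≤ δ⁻¹e^{δΣz²}` (`1 + x ≤ eˣ`). [folklore] -/
theorem sum_sq_le_inv_mul_exp {δ : ℝ} (hδ : 0 < δ) (z : σ → ℝ) : ∑ i, z i ^ 2 ≤ δ⁻¹ * exp (δ * ∑ i, z i ^ 2) := by
  have h := Real.add_one_le_exp (δ * ∑ i, z i ^ 2)
  rw [le_inv_mul_iff₀ hδ]
  linarith

omit [Fintype σ] [DecidableEq σ] in
/-- `|Σ_x f_x(Pz)_x| ≤ ½(Σf² + Σ(Pz)²)`. [folklore] -/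
theorem abs_pairing_le (f : ι → ℝ) (z : σ → ℝ) : |∑ x, f x * P z x| ≤ (∑ x, f x ^ 2 + ∑ x, P z x ^ 2) / 2 := by
  refine (Finset.abs_sum_le_sum_abs _ _).trans ?_
  rw [← Finset.sum_add_distrib, le_div_iff₀ (by norm_num : (0 : ℝ) < 2), Finset.sum_mul]
  refine Finset.sum_le_sum fun x _ => ?_
  rw [abs_mul]
  nlinarith [sq_nonneg (|f x| - |P z x|), abs_mul_abs_self (f x), abs_mul_abs_self (P z x)]

/-- Monotonicity of the envelope: `a ≤ b`, `0 ≤ S` ⟹ `e^{aS} ≤ e^{bS}`. [folklore] -/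
theorem exp_mul_le_exp_mul_of_le {a b S : ℝ} (hab : a ≤ b) (hS : 0 ≤ S) : exp (a * S) ≤ exp (b * S) :=
  exp_le_exp.2 (mul_le_mul_of_nonneg_right hab hS)

/-! ## §2. THE END: the tilted IBP for the envelope class -/

/-- **THE END — THE TILTED GAUSSIAN IBP ON THE FIBRE, INTEGRABILITY DISCHARGED.**  `H` symmetric with floor `m > 0`; chart bounds
`pΣz² ≤ Σ(Pz)² ≤ qΣz²` (`p > 0`, `q ≥ 0`); `M_z(j,k) = H(Pe_j)(Pe_k)`; `G, W` differentiable everywhere; `u = Cf` the covariance vector;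
envelope letters `|G(φ)|, |DG(φ)u|, |DW(φ)u| ≤ A·e^{cΣφ²}` (`A, c ≥ 0`), stability `−κ₀Σφ² ≤ W(φ)` (`κ₀ ≥ 0`); room `(2c+κ₀)q + δ < mp∕2` for
some `δ > 0` ⟹ `∫ ⟨f,Pz⟩G(Pz)e^{−W(Pz)}ρ dz = ∫ (DG(Pz)u − G(Pz)·DW(Pz)u)e^{−W(Pz)}ρ dz`. [folklore] -/
theorem fibre_gaussian_ibp_tilted_of_envelope (hHsym : ∀ h k : ι → ℝ, H h k = H k h)
    (hfl : ∀ h : ι → ℝ, m * ∑ x, h x ^ 2 ≤ H h h) (hm : 0 < m) (hP : ∀ z : σ → ℝ, p * ∑ i, z i ^ 2 ≤ ∑ x, P z x ^ 2) (hp : 0 < p)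
    {q : ℝ} (hq : 0 ≤ q) (hPq : ∀ z : σ → ℝ, ∑ x, P z x ^ 2 ≤ q * ∑ i, z i ^ 2)
    (Mz : Matrix σ σ ℝ) (hMz : ∀ j k, Mz j k = H (P (Pi.single j 1)) (P (Pi.single k 1))) {G W : (ι → ℝ) → ℝ}
    (hG : ∀ v, DifferentiableAt ℝ G v) (hW : ∀ v, DifferentiableAt ℝ W v) (f : ι → ℝ) (u : ι → ℝ)
    (hu : u = fun x => ∑ y, (∑ j, ∑ k, P (Pi.single j 1) x * Mz⁻¹ j k * P (Pi.single k 1) y) * f y)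
    {A c κ₀ δ : ℝ} (hA : 0 ≤ A) (hc : 0 ≤ c) (hκ₀ : 0 ≤ κ₀) (hδ : 0 < δ) (hroom : (2 * c + κ₀) * q + δ < m * p / 2)
    (hGb : ∀ φ : ι → ℝ, |G φ| ≤ A * exp (c * ∑ x, φ x ^ 2)) (hDGb : ∀ φ : ι → ℝ, |fderiv ℝ G φ u| ≤ A * exp (c * ∑ x, φ x ^ 2))
    (hWst : ∀ φ : ι → ℝ, -(κ₀ * ∑ x, φ x ^ 2) ≤ W φ) (hDWb : ∀ φ : ι → ℝ, |fderiv ℝ W φ u| ≤ A * exp (c * ∑ x, φ x ^ 2)) :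
    ∫ z : σ → ℝ, (∑ x, f x * P z x) * (G (P z) * exp (-W (P z))) * exp (-((1 / 2 : ℝ) * H (P z) (P z)))
      = ∫ z : σ → ℝ,
          (fderiv ℝ G (P z) (fun x => ∑ y, (∑ j, ∑ k, P (Pi.single j 1) x * Mz⁻¹ j k * P (Pi.single k 1) y) * f y)
            - G (P z) * fderiv ℝ W (P z) (fun x => ∑ y, (∑ j, ∑ k, P (Pi.single j 1) x * Mz⁻¹ j k * P (Pi.single k 1) y) * f y))
          * exp (-W (P z)) * exp (-((1 / 2 : ℝ) * H (P z) (P z))) := by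
  subst hu
  -- measurability letters
  have hGd : Differentiable ℝ G := fun v => hG v
  have hWd : Differentiable ℝ W := fun v => hW v
  have hGc : Continuous G := hGd.continuous
  have hWc : Continuous W := hWd.continuous
  have hGPm : AEStronglyMeasurable (fun z : σ → ℝ => G (P z)) volume := (hGc.comp P.continuous).aestronglyMeasurable
  have hEm : AEStronglyMeasurable (fun z : σ → ℝ => exp (-W (P z))) volume :=
    (continuous_exp.comp (hWc.comp P.continuous).neg).aestronglyMeasurable
  have hLm : AEStronglyMeasurable (fun z : σ → ℝ => ∑ x, f x * P z x) volume :=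
    (continuous_finsetSum _ fun x _ => ((continuous_apply x).comp P.continuous).const_mul _).aestronglyMeasurable
  have hDGm : AEStronglyMeasurable (fun z : σ → ℝ => fderiv ℝ G (P z)
      (fun x => ∑ y, (∑ j, ∑ k, P (Pi.single j 1) x * Mz⁻¹ j k * P (Pi.single k 1) y) * f y)) volume :=
    ((measurable_fderiv_apply_const ℝ G _).comp P.continuous.measurable).aestronglyMeasurable
  have hDWm : AEStronglyMeasurable (fun z : σ → ℝ => fderiv ℝ W (P z)
      (fun x => ∑ y, (∑ j, ∑ k, P (Pi.single j 1) x * Mz⁻¹ j k * P (Pi.single k 1) y) * f y)) volume :=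
    ((measurable_fderiv_apply_const ℝ W _).comp P.continuous.measurable).aestronglyMeasurable
  -- pointwise envelope letters in the chart variable
  have hS0 : ∀ z : σ → ℝ, 0 ≤ ∑ i, z i ^ 2 := fun z => Finset.sum_nonneg fun i _ => sq_nonneg _
  have hGz : ∀ z : σ → ℝ, |G (P z)| ≤ A * exp (c * q * ∑ i, z i ^ 2) := fun z =>
    (hGb (P z)).trans (mul_le_mul_of_nonneg_left (by
      rw [mul_assoc]; exact exp_le_exp.2 (mul_le_mul_of_nonneg_left (hPq z) hc)) hA)
  have hDGz : ∀ z : σ → ℝ, |fderiv ℝ G (P z)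
      (fun x => ∑ y, (∑ j, ∑ k, P (Pi.single j 1) x * Mz⁻¹ j k * P (Pi.single k 1) y) * f y)| ≤
      A * exp (c * q * ∑ i, z i ^ 2) := fun z =>
    (hDGb (P z)).trans (mul_le_mul_of_nonneg_left (by
      rw [mul_assoc]; exact exp_le_exp.2 (mul_le_mul_of_nonneg_left (hPq z) hc)) hA)
  have hDWz : ∀ z : σ → ℝ, |fderiv ℝ W (P z)
      (fun x => ∑ y, (∑ j, ∑ k, P (Pi.single j 1) x * Mz⁻¹ j k * P (Pi.single k 1) y) * f y)| ≤
      A * exp (c * q * ∑ i, z i ^ 2) := fun z =>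
    (hDWb (P z)).trans (mul_le_mul_of_nonneg_left (by
      rw [mul_assoc]; exact exp_le_exp.2 (mul_le_mul_of_nonneg_left (hPq z) hc)) hA)
  have hEz : ∀ z : σ → ℝ, exp (-W (P z)) ≤ exp (κ₀ * q * ∑ i, z i ^ 2) := fun z => by
    refine exp_le_exp.2 ?_
    have h1 := hWst (P z)
    have h2 := mul_le_mul_of_nonneg_left (hPq z) hκ₀
    linarith
  -- h3 : `G e^{−W} ρ`
  have h3 : Integrable fun z : σ → ℝ => G (P z) * exp (-W (P z)) * exp (-((1 / 2 : ℝ) * H (P z) (P z))) := by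
    refine integrable_of_gaussian_envelope P hfl hm.le hP (hGPm.mul hEm) (A := A) (c := (2 * c + κ₀) * q + δ) (by linarith)
      fun z => ?_
    rw [abs_mul, abs_of_pos (exp_pos _)]
    calc |G (P z)| * exp (-W (P z)) ≤ A * exp (c * q * ∑ i, z i ^ 2) * exp (κ₀ * q * ∑ i, z i ^ 2) :=
          mul_le_mul (hGz z) (hEz z) (exp_pos _).le (by positivity)
      _ = A * exp ((c * q + κ₀ * q) * ∑ i, z i ^ 2) := by rw [mul_assoc, ← exp_add]; ring_nf
      _ ≤ A * exp (((2 * c + κ₀) * q + δ) * ∑ i, z i ^ 2) :=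
          mul_le_mul_of_nonneg_left (exp_mul_le_exp_mul_of_le (by nlinarith) (hS0 z)) hA
  -- h1 : `⟨f,Pz⟩ G e^{−W} ρ`
  have h1 : Integrable fun z : σ → ℝ => (∑ x, f x * P z x) * (G (P z) * exp (-W (P z))) *
      exp (-((1 / 2 : ℝ) * H (P z) (P z))) := by
    refine integrable_of_gaussian_envelope P hfl hm.le hP (hLm.mul (hGPm.mul hEm)) (A := (∑ x, f x ^ 2 + q * δ⁻¹) / 2 * A)
      (c := (2 * c + κ₀) * q + δ) (by linarith) fun z => ?_
    have hlin : |∑ x, f x * P z x| ≤ (∑ x, f x ^ 2 + q * δ⁻¹) / 2 * exp (δ * ∑ i, z i ^ 2) := by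
      have h0 := abs_pairing_le P f z
      have h2 := sum_sq_le_inv_mul_exp hδ z
      have h4 : (1 : ℝ) ≤ exp (δ * ∑ i, z i ^ 2) := one_le_exp (by positivity)
      have hf0 : 0 ≤ ∑ x, f x ^ 2 := Finset.sum_nonneg fun x _ => sq_nonneg _
      have h5 : ∑ x, P z x ^ 2 ≤ q * (δ⁻¹ * exp (δ * ∑ i, z i ^ 2)) := (hPq z).trans (mul_le_mul_of_nonneg_left h2 hq)
      nlinarith [mul_le_mul_of_nonneg_left h4 hf0]
    rw [abs_mul, abs_mul, abs_of_pos (exp_pos _)]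
    have hB0 : 0 ≤ (∑ x, f x ^ 2 + q * δ⁻¹) / 2 := by
      have : 0 ≤ ∑ x, f x ^ 2 := Finset.sum_nonneg fun x _ => sq_nonneg _
      positivity
    calc |∑ x, f x * P z x| * (|G (P z)| * exp (-W (P z)))
        ≤ ((∑ x, f x ^ 2 + q * δ⁻¹) / 2 * exp (δ * ∑ i, z i ^ 2)) *
            (A * exp (c * q * ∑ i, z i ^ 2) * exp (κ₀ * q * ∑ i, z i ^ 2)) :=
          mul_le_mul hlin (mul_le_mul (hGz z) (hEz z) (exp_pos _).le (by positivity)) (by positivity) (by positivity)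
      _ = (∑ x, f x ^ 2 + q * δ⁻¹) / 2 * A * exp ((δ + c * q + κ₀ * q) * ∑ i, z i ^ 2) := by
          rw [add_mul, add_mul, exp_add, exp_add]; ring
      _ ≤ (∑ x, f x ^ 2 + q * δ⁻¹) / 2 * A * exp (((2 * c + κ₀) * q + δ) * ∑ i, z i ^ 2) :=
          mul_le_mul_of_nonneg_left (exp_mul_le_exp_mul_of_le (by nlinarith) (hS0 z)) (by positivity)
  -- h2 : `(DG u − G·DW u) e^{−W} ρ`
  have h2 : Integrable fun z : σ → ℝ =>
      (fderiv ℝ G (P z) (fun x => ∑ y, (∑ j, ∑ k, P (Pi.single j 1) x * Mz⁻¹ j k * P (Pi.single k 1) y) * f y)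
          - G (P z) * fderiv ℝ W (P z) (fun x => ∑ y, (∑ j, ∑ k, P (Pi.single j 1) x * Mz⁻¹ j k * P (Pi.single k 1) y) * f y))
        * exp (-W (P z)) * exp (-((1 / 2 : ℝ) * H (P z) (P z))) := by
    refine integrable_of_gaussian_envelope P hfl hm.le hP ((hDGm.sub (hGPm.mul hDWm)).mul hEm) (A := A + A * A)
      (c := (2 * c + κ₀) * q + δ) (by linarith) fun z => ?_
    rw [abs_mul, abs_of_pos (exp_pos _)]
    have hdiff : |fderiv ℝ G (P z) (fun x => ∑ y, (∑ j, ∑ k, P (Pi.single j 1) x * Mz⁻¹ j k * P (Pi.single k 1) y) * f y)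
        - G (P z) * fderiv ℝ W (P z) (fun x => ∑ y, (∑ j, ∑ k, P (Pi.single j 1) x * Mz⁻¹ j k * P (Pi.single k 1) y) * f y)| ≤
        (A + A * A) * exp (2 * c * q * ∑ i, z i ^ 2) := by
      refine (abs_sub _ _).trans ?_
      rw [abs_mul]
      have e1 : exp (c * q * ∑ i, z i ^ 2) ≤ exp (2 * c * q * ∑ i, z i ^ 2) :=
        exp_mul_le_exp_mul_of_le (by nlinarith) (hS0 z)
      have e2 : exp (c * q * ∑ i, z i ^ 2) * exp (c * q * ∑ i, z i ^ 2) = exp (2 * c * q * ∑ i, z i ^ 2) := by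
        rw [← exp_add]; ring_nf
      have hp1 := (hDGz z).trans (mul_le_mul_of_nonneg_left e1 hA)
      have hp2 : |G (P z)| * |fderiv ℝ W (P z)
          (fun x => ∑ y, (∑ j, ∑ k, P (Pi.single j 1) x * Mz⁻¹ j k * P (Pi.single k 1) y) * f y)| ≤
          A * A * exp (2 * c * q * ∑ i, z i ^ 2) := by
        calc _ ≤ (A * exp (c * q * ∑ i, z i ^ 2)) * (A * exp (c * q * ∑ i, z i ^ 2)) :=
              mul_le_mul (hGz z) (hDWz z) (abs_nonneg _) (by positivity)
          _ = A * A * exp (2 * c * q * ∑ i, z i ^ 2) := by rw [← e2]; ring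
      linarith
    calc _ ≤ (A + A * A) * exp (2 * c * q * ∑ i, z i ^ 2) * exp (κ₀ * q * ∑ i, z i ^ 2) :=
          mul_le_mul hdiff (hEz z) (exp_pos _).le (by positivity)
      _ = (A + A * A) * exp ((2 * c * q + κ₀ * q) * ∑ i, z i ^ 2) := by rw [mul_assoc, ← exp_add]; ring_nf
      _ ≤ (A + A * A) * exp (((2 * c + κ₀) * q + δ) * ∑ i, z i ^ 2) :=
          mul_le_mul_of_nonneg_left (exp_mul_le_exp_mul_of_le (by nlinarith) (hS0 z)) (by positivity)
  exact fibre_gaussian_ibp_tilted P hHsym hfl hm hP hp Mz hMz hG hW f h1 h2 h3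

/-! ## §3. Toy -/

/-- Toy (§1): the envelope bound `Σz² ≤ δ⁻¹e^{δΣz²}` at `δ = 1` on one coordinate. -/
example (z : Fin 1 → ℝ) : ∑ i, z i ^ 2 ≤ (1 : ℝ)⁻¹ * exp (1 * ∑ i, z i ^ 2) := sum_sq_le_inv_mul_exp one_pos z

end Summit.QuantumFields.BalabanUV.T4Continuum.NE7b.SupFibreGaussianIBPEnvelope
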